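import Mathlib.MeasureTheory.Integral.IntervalIntegral.Basic
import Mathlib.MeasureTheory.Integral.IntervalIntegral.Periodic
import Mathlib.Topology.Order.Compact
import Mathlib.Topology.Order.Monotone
import Mathlib.Topology.EMetricSpace.Lipschitz
import HarnessLib

/-!
# The Lax–Hopf formula for Burgers' equation, I: minimizers of the Lax function

For bounded measurable data `u₀ : ℝ → ℝ`, `|u₀| ≤ M`, E. Hopf (1950) and P. Lax (1957) construct the
admissible solution of the Cauchy problem for the inviscid Burgers equation
`∂ₜ u + ∂ₓ (u²/2) = 0`, `u(0,·) = u₀`, from the minimizers of the *Lax function*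
`F(t,x,y) = ∫₀ʸ u₀ + (x - y)²/(2t)` (Hörmander (2.4.6); Dafermos (11.4.8) with `g(v) = v²/2`):
if `y₊(t,x)` denotes the LARGEST minimizer of `F(t,x,·)` then
`u(t,x) = (x - y₊(t,x))/t` (Hörmander (2.4.7)′/(2.4.7)″, Dafermos (11.4.10) `u(x+,t)`).
This file sets up these objects and proves the order-theoretic half of Hörmander's Thm 2.4.2:

* `burgersPrimitive u₀` (`U₀(y) = ∫₀ʸ u₀`, `M`-Lipschitz), `laxFunction u₀ t x y`, the minimizer
  set `laxArgmin u₀ t x`, `laxMinimizer u₀ t x = y₊(t,x)`, `hopfSolution u₀ t x = (x - y₊)/t`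
  (and `0` for `t ≤ 0`).
* minimizers exist, form a closed set, and satisfy `|x - y| ≤ M t` (so `|u| ≤ M`, the bound of
  Thm 2.4.2); `y₊` is a minimizer.
* the comparison lemma `laxMinimizer_mono`: `x₂ ≥ x₁ + M |t₂ - t₁| ⇒ y₊(t₁,x₁) ≤ y₊(t₂,x₂)`.
  For `t₁ = t₂` this is Hörmander's Lemma 2.4.1 (`y₊(t,·)` is nondecreasing), which gives
  OLEĬNIK'S CONDITION E `u(t,x₂) - u(t,x₁) ≤ (x₂ - x₁)/t` pointwise (`hopfSolution_sub_le`,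
  Hörmander (2.4.8)); for `t₁ ≠ t₂` it is finite speed of propagation (`≤ M`) of the minimizer map,
  used downstream for continuity in time.
* the Hopf–Lax potential `hopfLaxPotential u₀ t x = W(t,x) = min_y F(t,x,y)` (Hörmander's
  `m(t,x)`; Evans §3.4.2), extended by `U₀` for `t ≤ 0`, with `U₀(x) - M²t/2 ≤ W(t,x) ≤ U₀(x)`.

The analytic half (right continuity and periodicity of `y₊(t,·)`, Lipschitz bounds on `W`, the
identities `∂ₓW = u`, `∂ₜW = -u²/2`, the weak form of the Cauchy problem, continuity in time) is in
the companion files `BurgersHopfLaxPotential.lean` and `BurgersHopfLaxWeakSolution.lean`.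
Deliberately NOT here: the smallest minimizer `y₋`, the vanishing-viscosity derivation
(Hopf–Cole, Hörmander (2.4.5)), general convex fluxes (Dafermos's `g = f*`).

## References

* L. Hörmander, *Lectures on Nonlinear Hyperbolic Differential Equations* (1997), §2.4:
  (2.4.6), Lemma 2.4.1, Thm 2.4.2, (2.4.7)′–(2.4.8). [Hormander1997]
* C. M. Dafermos, *Hyperbolic Conservation Laws in Continuum Physics*, 2nd ed. (2005), §11.4:
  (11.4.7), (11.4.8), Thm 11.4.3, (11.4.10). [Dafermos2005]
* E. Hopf, CPAM 3 (1950) 201–230 [Hopf1950]; L. C. Evans, *Partial Differential Equations*,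
  2nd ed. (2010), §3.4.2 (Lax–Oleinik formula). [Evans2010]
-/

noncomputable section

open Set Filter MeasureTheory intervalIntegral
open scoped Topology

namespace Literature.Analysis.PDE

variable {u₀ : ℝ → ℝ} {M : ℝ}

/-! ### The primitive of the datum -/

/-- The primitive `U₀(y) = ∫₀ʸ u₀(z) dz` of the initial datum (Hörmander (2.4.6),
Dafermos (11.4.8)). [cite: Hormander1997, (2.4.6) §2.4] -/
def burgersPrimitive (u₀ : ℝ → ℝ) (y : ℝ) : ℝ :=
  ∫ z in (0 : ℝ)..y, u₀ z

/-- A bound `|u₀| ≤ M` forces `0 ≤ M`. [folklore] -/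
theorem nonneg_of_abs_le (hM : ∀ x, |u₀ x| ≤ M) : 0 ≤ M :=
  (abs_nonneg _).trans (hM 0)

/-- Bounded measurable data are interval integrable. [folklore] -/
theorem intervalIntegrable_of_abs_le (hm : Measurable u₀) (hM : ∀ x, |u₀ x| ≤ M) (a b : ℝ) :
    IntervalIntegrable u₀ volume a b :=
  (intervalIntegrable_const (c := M)).mono_fun' hm.aestronglyMeasurable
    (Eventually.of_forall fun x => by simpa [Real.norm_eq_abs] using hM x)

/-- `U₀(b) - U₀(a) = ∫ₐᵇ u₀`. [folklore] -/
theorem burgersPrimitive_sub (hm : Measurable u₀) (hM : ∀ x, |u₀ x| ≤ M) (a b : ℝ) :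
    burgersPrimitive u₀ b - burgersPrimitive u₀ a = ∫ z in a..b, u₀ z :=
  integral_interval_sub_left (intervalIntegrable_of_abs_le hm hM 0 b)
    (intervalIntegrable_of_abs_le hm hM 0 a)

/-- `|U₀(b) - U₀(a)| ≤ M |b - a|`. [folklore] -/
theorem abs_burgersPrimitive_sub_le (hm : Measurable u₀) (hM : ∀ x, |u₀ x| ≤ M) (a b : ℝ) :
    |burgersPrimitive u₀ b - burgersPrimitive u₀ a| ≤ M * |b - a| := by
  rw [burgersPrimitive_sub hm hM]
  have h := norm_integral_le_of_norm_le_const (a := a) (b := b) (C := M) (f := u₀)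
    fun x _ => by simpa [Real.norm_eq_abs] using hM x
  simpa [Real.norm_eq_abs] using h

/-- The primitive of data bounded by `M` is `M`-Lipschitz. [folklore] -/
theorem lipschitzWith_burgersPrimitive (hm : Measurable u₀) (hM : ∀ x, |u₀ x| ≤ M) :
    LipschitzWith (Real.toNNReal M) (burgersPrimitive u₀) :=
  LipschitzWith.of_dist_le_mul fun a b => by
    rw [Real.dist_eq, Real.dist_eq, Real.coe_toNNReal _ (nonneg_of_abs_le hM)]
    exact abs_burgersPrimitive_sub_le hm hM b a

/-- The primitive is continuous. [folklore] -/
theorem continuous_burgersPrimitive (hm : Measurable u₀) (hM : ∀ x, |u₀ x| ≤ M) :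
    Continuous (burgersPrimitive u₀) :=
  (lipschitzWith_burgersPrimitive hm hM).continuous

/-! ### The Lax function and its minimizers -/

/-- The **Lax function** `F(t,x,y) = U₀(y) + (x - y)²/(2t)` of Burgers' equation (Hörmander
(2.4.6); Dafermos (11.4.8) with Legendre transform `g(v) = v²/2` of the flux `u²/2`).
[cite: Dafermos2005, (11.4.8) §11.4] -/
def laxFunction (u₀ : ℝ → ℝ) (t x y : ℝ) : ℝ :=
  burgersPrimitive u₀ y + (x - y) ^ 2 / (2 * t)

/-- The set of minimizers of the Lax function `F(t,x,·)` over `ℝ` (a compact interval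
`[y₋(t,x), y₊(t,x)]` contains it, Hörmander §2.4). [cite: Hormander1997, §2.4 Lemma 2.4.1] -/
def laxArgmin (u₀ : ℝ → ℝ) (t x : ℝ) : Set ℝ :=
  {y | ∀ z, laxFunction u₀ t x y ≤ laxFunction u₀ t x z}

/-- **`y₊(t,x)`, the largest minimizer of the Lax function** `F(t,x,·)` (Hörmander §2.4;
Dafermos (11.4.10)). [cite: Hormander1997, §2.4 Lemma 2.4.1] -/
def laxMinimizer (u₀ : ℝ → ℝ) (t x : ℝ) : ℝ :=
  sSup (laxArgmin u₀ t x)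

/-- **Hopf's solution of Burgers' equation** `u(t,x) = (x - y₊(t,x))/t` for `t > 0`
(Hörmander Thm 2.4.2, (2.4.7)′; Dafermos (11.4.10): the right trace `u(x+,t)`), extended by `0`
to `t ≤ 0`. [cite: Hormander1997, Thm 2.4.2] -/
def hopfSolution (u₀ : ℝ → ℝ) (t x : ℝ) : ℝ :=
  if 0 < t then (x - laxMinimizer u₀ t x) / t else 0

/-- The Lax function at `y = x` is `U₀(x)`. [folklore] -/
@[simp] theorem laxFunction_self (u₀ : ℝ → ℝ) (t x : ℝ) :
    laxFunction u₀ t x x = burgersPrimitive u₀ x := by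
  simp [laxFunction]

/-- The Lax function is jointly continuous in `(x, y)`. [folklore] -/
theorem continuous_laxFunction_uncurry (hm : Measurable u₀) (hM : ∀ x, |u₀ x| ≤ M) (t : ℝ) :
    Continuous fun q : ℝ × ℝ => laxFunction u₀ t q.1 q.2 := by
  have hc := continuous_burgersPrimitive hm hM
  unfold laxFunction
  fun_prop

/-- The Lax function is continuous in `y`. [folklore] -/
theorem continuous_laxFunction (hm : Measurable u₀) (hM : ∀ x, |u₀ x| ≤ M) (t x : ℝ) :
    Continuous (laxFunction u₀ t x) :=
  (continuous_laxFunction_uncurry hm hM t).comp (continuous_const.prodMk continuous_id)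

/-- Lower bound `F(t,x,y) ≥ U₀(x) - M|x - y| + (x - y)²/(2t)`. [folklore] -/
theorem laxFunction_ge (hm : Measurable u₀) (hM : ∀ x, |u₀ x| ≤ M) (t x y : ℝ) :
    burgersPrimitive u₀ x - M * |x - y| + (x - y) ^ 2 / (2 * t) ≤ laxFunction u₀ t x y := by
  have h := abs_burgersPrimitive_sub_le hm hM y x
  have h' := (le_abs_self _).trans h
  unfold laxFunction
  linarith

/-- Lower bound `F(t,x,y) ≥ U₀(x) - M² t/2` for `t > 0`. [folklore] -/
theorem laxFunction_ge' (hm : Measurable u₀) (hM : ∀ x, |u₀ x| ≤ M) {t : ℝ} (ht : 0 < t)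
    (x y : ℝ) : burgersPrimitive u₀ x - M ^ 2 * t / 2 ≤ laxFunction u₀ t x y := by
  have h := laxFunction_ge hm hM t x y
  have hsq : -(M * |x - y|) + (x - y) ^ 2 / (2 * t) + M ^ 2 * t / 2
      = (|x - y| - M * t) ^ 2 / (2 * t) := by
    field_simp
    rw [← sq_abs (x - y)]
    ring
  have hnn : 0 ≤ (|x - y| - M * t) ^ 2 / (2 * t) := by positivity
  linarith

/-- **Minimizers of the Lax function exist** (`F(t,x,·)` is continuous and coercive; Hörmander
§2.4 "the minimum is achieved in a compact set"). [cite: Hormander1997, §2.4] -/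
theorem laxArgmin_nonempty (hm : Measurable u₀) (hM : ∀ x, |u₀ x| ≤ M) {t : ℝ} (ht : 0 < t)
    (x : ℝ) : (laxArgmin u₀ t x).Nonempty := by
  have hM0 := nonneg_of_abs_le hM
  set K : Set ℝ := Icc (x - 2 * M * t) (x + 2 * M * t) with hK
  have hxK : x ∈ K := ⟨by nlinarith, by nlinarith⟩
  obtain ⟨y, -, hy⟩ := (isCompact_Icc : IsCompact K).exists_isMinOn ⟨x, hxK⟩
    (continuous_laxFunction hm hM t x).continuousOn
  rw [isMinOn_iff] at hy
  refine ⟨y, fun z => ?_⟩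
  by_cases hz : z ∈ K
  · exact hy z hz
  · have hMt : 0 ≤ M * t := mul_nonneg hM0 ht.le
    have hfar : 2 * M * t ≤ |x - z| := by
      simp only [hK, mem_Icc, not_and_or, not_le] at hz
      rcases hz with hz | hz
      · rw [abs_of_nonneg (by linarith)]
        linarith
      · rw [abs_of_nonpos (by linarith)]
        linarith
    have hge := laxFunction_ge hm hM t x z
    have hprod : 0 ≤ |x - z| * (|x - z| - 2 * M * t) / (2 * t) := by
      have : 0 ≤ |x - z| - 2 * M * t := by linarith
      positivity
    have heq : -(M * |x - z|) + (x - z) ^ 2 / (2 * t) = |x - z| * (|x - z| - 2 * M * t) / (2 * t) := by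
      field_simp
      rw [← sq_abs (x - z)]
      ring
    calc laxFunction u₀ t x y ≤ laxFunction u₀ t x x := hy x hxK
      _ = burgersPrimitive u₀ x := laxFunction_self u₀ t x
      _ ≤ laxFunction u₀ t x z := by linarith

/-- **Minimizers lie within `M t` of `x`** (so `|u| ≤ M`, Hörmander Thm 2.4.2 "If `|u₀| ≤ M` then
`|u| ≤ M`"): otherwise moving `y` towards `x` decreases `F`. [cite: Hormander1997, Thm 2.4.2] -/
theorem abs_sub_le_of_mem_laxArgmin (hm : Measurable u₀) (hM : ∀ x, |u₀ x| ≤ M) {t : ℝ}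
    (ht : 0 < t) {x y : ℝ} (hy : y ∈ laxArgmin u₀ t x) : |x - y| ≤ M * t := by
  rw [abs_le]
  constructor
  · -- if `y - x > M t`, compare with `y - d`, `d = y - x - M t`
    by_contra h
    push Not at h
    set d := y - x - M * t with hd_def
    have hd : 0 < d := by linarith
    have key := hy (y - d)
    have hU : burgersPrimitive u₀ (y - d) - burgersPrimitive u₀ y ≤ M * d := by
      have h1 := abs_burgersPrimitive_sub_le hm hM y (y - d)
      rw [show y - d - y = -d by ring, abs_neg, abs_of_pos hd] at h1
      exact (le_abs_self _).trans h1
    unfold laxFunction at key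
    have e1 : x - (y - d) = -(M * t) := by rw [hd_def]; ring
    have e2 : x - y = -(M * t) - d := by rw [hd_def]; ring
    rw [e1, e2] at key
    have e3 : (-(M * t) - d) ^ 2 / (2 * t) - (-(M * t)) ^ 2 / (2 * t)
        = M * d + d ^ 2 / (2 * t) := by
      field_simp
      ring
    have hpos : 0 < d ^ 2 / (2 * t) := by positivity
    linarith
  · -- if `x - y > M t`, compare with `y + d`, `d = x - y - M t`
    by_contra h
    push Not at h
    set d := x - y - M * t with hd_def
    have hd : 0 < d := by linarith
    have key := hy (y + d)
    have hU : burgersPrimitive u₀ (y + d) - burgersPrimitive u₀ y ≤ M * d := by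
      have h1 := abs_burgersPrimitive_sub_le hm hM y (y + d)
      rw [show y + d - y = d by ring, abs_of_pos hd] at h1
      exact (le_abs_self _).trans h1
    unfold laxFunction at key
    have e1 : x - (y + d) = M * t := by rw [hd_def]; ring
    have e2 : x - y = M * t + d := by rw [hd_def]; ring
    rw [e1, e2] at key
    have e3 : (M * t + d) ^ 2 / (2 * t) - (M * t) ^ 2 / (2 * t) = M * d + d ^ 2 / (2 * t) := by
      field_simp
      ring
    have hpos : 0 < d ^ 2 / (2 * t) := by positivity
    linarith

/-- The minimizer set is closed. [folklore] -/
theorem isClosed_laxArgmin (hm : Measurable u₀) (hM : ∀ x, |u₀ x| ≤ M) (t x : ℝ) :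
    IsClosed (laxArgmin u₀ t x) := by
  have h : laxArgmin u₀ t x = ⋂ z, {y | laxFunction u₀ t x y ≤ laxFunction u₀ t x z} := by
    ext y
    simp [laxArgmin]
  rw [h]
  exact isClosed_iInter fun z => isClosed_le (continuous_laxFunction hm hM t x) continuous_const

/-- The minimizer set is contained in `[x - M t, x + M t]`. [folklore] -/
theorem laxArgmin_subset_Icc (hm : Measurable u₀) (hM : ∀ x, |u₀ x| ≤ M) {t : ℝ} (ht : 0 < t)
    (x : ℝ) : laxArgmin u₀ t x ⊆ Icc (x - M * t) (x + M * t) := fun y hy => by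
  have h := abs_le.1 (abs_sub_le_of_mem_laxArgmin hm hM ht hy)
  constructor <;> linarith [h.1, h.2]

/-- The minimizer set is bounded above. [folklore] -/
theorem bddAbove_laxArgmin (hm : Measurable u₀) (hM : ∀ x, |u₀ x| ≤ M) {t : ℝ} (ht : 0 < t)
    (x : ℝ) : BddAbove (laxArgmin u₀ t x) :=
  bddAbove_Icc.mono (laxArgmin_subset_Icc hm hM ht x)

/-- **`y₊(t,x)` is a minimizer** (the minimizer set is compact and nonempty).
[cite: Hormander1997, §2.4 Lemma 2.4.1] -/
theorem laxMinimizer_mem (hm : Measurable u₀) (hM : ∀ x, |u₀ x| ≤ M) {t : ℝ} (ht : 0 < t)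
    (x : ℝ) : laxMinimizer u₀ t x ∈ laxArgmin u₀ t x :=
  (isClosed_laxArgmin hm hM t x).csSup_mem (laxArgmin_nonempty hm hM ht x)
    (bddAbove_laxArgmin hm hM ht x)

/-- Every minimizer is `≤ y₊(t,x)`. [folklore] -/
theorem le_laxMinimizer (hm : Measurable u₀) (hM : ∀ x, |u₀ x| ≤ M) {t : ℝ} (ht : 0 < t)
    {x y : ℝ} (hy : y ∈ laxArgmin u₀ t x) : y ≤ laxMinimizer u₀ t x :=
  le_csSup (bddAbove_laxArgmin hm hM ht x) hy

/-- `F(t,x,y₊(t,x)) ≤ F(t,x,z)` for all `z`. [folklore] -/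
theorem laxFunction_laxMinimizer_le (hm : Measurable u₀) (hM : ∀ x, |u₀ x| ≤ M) {t : ℝ}
    (ht : 0 < t) (x z : ℝ) :
    laxFunction u₀ t x (laxMinimizer u₀ t x) ≤ laxFunction u₀ t x z :=
  laxMinimizer_mem hm hM ht x z

/-- `|x - y₊(t,x)| ≤ M t`. [cite: Hormander1997, Thm 2.4.2] -/
theorem abs_sub_laxMinimizer_le (hm : Measurable u₀) (hM : ∀ x, |u₀ x| ≤ M) {t : ℝ}
    (ht : 0 < t) (x : ℝ) : |x - laxMinimizer u₀ t x| ≤ M * t :=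
  abs_sub_le_of_mem_laxArgmin hm hM ht (laxMinimizer_mem hm hM ht x)

/-- Hopf's solution for `t > 0`. [folklore] -/
theorem hopfSolution_of_pos (u₀ : ℝ → ℝ) {t : ℝ} (ht : 0 < t) (x : ℝ) :
    hopfSolution u₀ t x = (x - laxMinimizer u₀ t x) / t := by
  simp [hopfSolution, ht]

/-- Hopf's solution vanishes (by convention) for `t ≤ 0`. [folklore] -/
theorem hopfSolution_of_nonpos (u₀ : ℝ → ℝ) {t : ℝ} (ht : t ≤ 0) (x : ℝ) :
    hopfSolution u₀ t x = 0 := by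
  simp [hopfSolution, not_lt.2 ht]

/-- **`|u| ≤ M`** (Hörmander Thm 2.4.2: "If `|u₀| ≤ M` then `|u| ≤ M`").
[cite: Hormander1997, Thm 2.4.2] -/
theorem abs_hopfSolution_le (hm : Measurable u₀) (hM : ∀ x, |u₀ x| ≤ M) (t x : ℝ) :
    |hopfSolution u₀ t x| ≤ M := by
  by_cases ht : 0 < t
  · rw [hopfSolution_of_pos u₀ ht, abs_div, abs_of_pos ht, div_le_iff₀ ht]
    exact abs_sub_laxMinimizer_le hm hM ht x
  · rw [hopfSolution_of_nonpos u₀ (not_lt.1 ht), abs_zero]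
    exact nonneg_of_abs_le hM

/-! ### The comparison lemma: monotonicity and finite speed of propagation of `y₊` -/

/-- **Comparison of largest minimizers** (Hörmander Lemma 2.4.1, extended off the diagonal
`t₁ = t₂`): if `x₂ ≥ x₁ + M|t₂ - t₁|` then `y₊(t₁,x₁) ≤ y₊(t₂,x₂)`. Proof: the difference
`F(t₁,x₁,·) - F(t₂,x₂,·)` is nondecreasing on the interval containing both minimizer sets, so if
`y₊(t₂,x₂) < y₊(t₁,x₁)` then `y₊(t₁,x₁)` would also minimize `F(t₂,x₂,·)`. For `t₁ = t₂` this is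
the printed monotonicity of `y₊(t,·)`; in general it is finite speed of propagation.
[cite: Hormander1997, Lemma 2.4.1] -/
theorem laxMinimizer_mono (hm : Measurable u₀) (hM : ∀ x, |u₀ x| ≤ M) {t₁ t₂ x₁ x₂ : ℝ}
    (ht₁ : 0 < t₁) (ht₂ : 0 < t₂) (hx : x₁ + M * |t₂ - t₁| ≤ x₂) :
    laxMinimizer u₀ t₁ x₁ ≤ laxMinimizer u₀ t₂ x₂ := by
  set y₁ := laxMinimizer u₀ t₁ x₁ with hy₁
  set y₂ := laxMinimizer u₀ t₂ x₂ with hy₂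
  by_contra h
  push Not at h
  have hb₁ := abs_le.1 (abs_sub_laxMinimizer_le hm hM ht₁ x₁)
  have hb₂ := abs_le.1 (abs_sub_laxMinimizer_le hm hM ht₂ x₂)
  rw [← hy₁] at hb₁
  rw [← hy₂] at hb₂
  have h1 := laxFunction_laxMinimizer_le hm hM ht₁ x₁ y₂
  rw [← hy₁] at h1
  -- the quadratic parts compare in the right direction on the relevant range
  have hP : 0 ≤ t₂ * ((x₁ - y₁) ^ 2 - (x₁ - y₂) ^ 2) - t₁ * ((x₂ - y₁) ^ 2 - (x₂ - y₂) ^ 2) := by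
    rcases le_total t₁ t₂ with h12 | h12
    · rw [abs_of_nonneg (sub_nonneg.2 h12)] at hx
      have hQ : 0 ≤ (t₂ - t₁) * (y₁ - x₁ + M * t₁) + (t₂ - t₁) * (y₂ - x₂ + M * t₂)
          + (t₁ + t₂) * (x₂ - x₁ - M * (t₂ - t₁)) := by
        have i1 := mul_nonneg (sub_nonneg.2 h12) (show 0 ≤ y₁ - x₁ + M * t₁ by linarith [hb₁.2])
        have i2 := mul_nonneg (sub_nonneg.2 h12) (show 0 ≤ y₂ - x₂ + M * t₂ by linarith [hb₂.2])
        have i3 := mul_nonneg (show 0 ≤ t₁ + t₂ by linarith)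
          (show 0 ≤ x₂ - x₁ - M * (t₂ - t₁) by linarith)
        linarith
      have heq : t₂ * ((x₁ - y₁) ^ 2 - (x₁ - y₂) ^ 2) - t₁ * ((x₂ - y₁) ^ 2 - (x₂ - y₂) ^ 2)
          = (y₁ - y₂) * ((t₂ - t₁) * (y₁ - x₁ + M * t₁) + (t₂ - t₁) * (y₂ - x₂ + M * t₂)
            + (t₁ + t₂) * (x₂ - x₁ - M * (t₂ - t₁))) := by ring
      rw [heq]
      exact mul_nonneg (sub_nonneg.2 h.le) hQ
    · rw [abs_of_nonpos (sub_nonpos.2 h12)] at hx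
      have hQ : 0 ≤ (t₁ - t₂) * (x₁ + M * t₁ - y₁) + (t₁ - t₂) * (x₂ + M * t₂ - y₂)
          + (t₁ + t₂) * (x₂ - x₁ - M * (t₁ - t₂)) := by
        have i1 := mul_nonneg (sub_nonneg.2 h12) (show 0 ≤ x₁ + M * t₁ - y₁ by linarith [hb₁.1])
        have i2 := mul_nonneg (sub_nonneg.2 h12) (show 0 ≤ x₂ + M * t₂ - y₂ by linarith [hb₂.1])
        have i3 := mul_nonneg (show 0 ≤ t₁ + t₂ by linarith)
          (show 0 ≤ x₂ - x₁ - M * (t₁ - t₂) by linarith)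
        linarith
      have heq : t₂ * ((x₁ - y₁) ^ 2 - (x₁ - y₂) ^ 2) - t₁ * ((x₂ - y₁) ^ 2 - (x₂ - y₂) ^ 2)
          = (y₁ - y₂) * ((t₁ - t₂) * (x₁ + M * t₁ - y₁) + (t₁ - t₂) * (x₂ + M * t₂ - y₂)
            + (t₁ + t₂) * (x₂ - x₁ - M * (t₁ - t₂))) := by ring
      rw [heq]
      exact mul_nonneg (sub_nonneg.2 h.le) hQ
  -- hence `y₁` minimizes `F(t₂,x₂,·)` as well
  have h3 : laxFunction u₀ t₂ x₂ y₁ ≤ laxFunction u₀ t₂ x₂ y₂ := by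
    unfold laxFunction at h1 ⊢
    have hdiv : 0 ≤ ((x₁ - y₁) ^ 2 - (x₁ - y₂) ^ 2) / (2 * t₁)
        - ((x₂ - y₁) ^ 2 - (x₂ - y₂) ^ 2) / (2 * t₂) := by
      have heq : ((x₁ - y₁) ^ 2 - (x₁ - y₂) ^ 2) / (2 * t₁)
          - ((x₂ - y₁) ^ 2 - (x₂ - y₂) ^ 2) / (2 * t₂)
          = (t₂ * ((x₁ - y₁) ^ 2 - (x₁ - y₂) ^ 2) - t₁ * ((x₂ - y₁) ^ 2 - (x₂ - y₂) ^ 2))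
            / (2 * t₁ * t₂) := by
        field_simp
      rw [heq]
      positivity
    have e1 : ((x₁ - y₁) ^ 2 - (x₁ - y₂) ^ 2) / (2 * t₁)
        = (x₁ - y₁) ^ 2 / (2 * t₁) - (x₁ - y₂) ^ 2 / (2 * t₁) := by ring
    have e2 : ((x₂ - y₁) ^ 2 - (x₂ - y₂) ^ 2) / (2 * t₂)
        = (x₂ - y₁) ^ 2 / (2 * t₂) - (x₂ - y₂) ^ 2 / (2 * t₂) := by ring
    linarith
  have hmem : y₁ ∈ laxArgmin u₀ t₂ x₂ := fun z =>
    h3.trans (by rw [hy₂]; exact laxFunction_laxMinimizer_le hm hM ht₂ x₂ z)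
  exact absurd (le_laxMinimizer hm hM ht₂ hmem) (not_le.2 h)

/-- **`y₊(t,·)` is nondecreasing** (Hörmander Lemma 2.4.1). [cite: Hormander1997, Lemma 2.4.1] -/
theorem laxMinimizer_monotone (hm : Measurable u₀) (hM : ∀ x, |u₀ x| ≤ M) {t : ℝ} (ht : 0 < t) :
    Monotone (laxMinimizer u₀ t) := fun x₁ x₂ h =>
  laxMinimizer_mono hm hM ht ht (by simpa using h)

/-- **Oleĭnik's condition E for Hopf's solution** (Hörmander (2.4.8), pointwise for the
representative `(x - y₊)/t`): `u(t,x₂) - u(t,x₁) ≤ (x₂ - x₁)/t` for `t > 0`, `x₁ ≤ x₂`.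
[cite: Hormander1997, Thm 2.4.2 (2.4.8)] -/
theorem hopfSolution_sub_le (hm : Measurable u₀) (hM : ∀ x, |u₀ x| ≤ M) {t : ℝ} (ht : 0 < t)
    {x₁ x₂ : ℝ} (hx : x₁ ≤ x₂) :
    hopfSolution u₀ t x₂ - hopfSolution u₀ t x₁ ≤ (x₂ - x₁) / t := by
  have hmono := laxMinimizer_monotone hm hM ht hx
  rw [hopfSolution_of_pos u₀ ht, hopfSolution_of_pos u₀ ht, div_sub_div_same]
  exact div_le_div_of_nonneg_right (by linarith) ht.le

/-! ### The Hopf–Lax potential -/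

/-- **The Hopf–Lax potential** `W(t,x) = min_y F(t,x,y) = F(t,x,y₊(t,x))` for `t > 0`
(Hörmander's `m(t,x)`, proof of Lemma 2.4.1; Evans's Hopf–Lax formula for the Hamilton–Jacobi
equation `∂ₜW + (∂ₓW)²/2 = 0`, `W(0,·) = U₀`, cf. Dafermos (11.4.11)), extended by `U₀(x)` for
`t ≤ 0`. Hopf's solution is `u = ∂ₓW`, `u²/2 = -∂ₜW` a.e. [cite: Evans2010, §3.4.2 Thm 1] -/
def hopfLaxPotential (u₀ : ℝ → ℝ) (t x : ℝ) : ℝ :=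
  if 0 < t then laxFunction u₀ t x (laxMinimizer u₀ t x) else burgersPrimitive u₀ x

/-- The potential for `t > 0`. [folklore] -/
theorem hopfLaxPotential_of_pos (u₀ : ℝ → ℝ) {t : ℝ} (ht : 0 < t) (x : ℝ) :
    hopfLaxPotential u₀ t x = laxFunction u₀ t x (laxMinimizer u₀ t x) := by
  simp [hopfLaxPotential, ht]

/-- The potential for `t ≤ 0` is `U₀`. [folklore] -/
theorem hopfLaxPotential_of_nonpos (u₀ : ℝ → ℝ) {t : ℝ} (ht : t ≤ 0) (x : ℝ) :
    hopfLaxPotential u₀ t x = burgersPrimitive u₀ x := by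
  simp [hopfLaxPotential, not_lt.2 ht]

/-- `W(t,x) ≤ F(t,x,z)` for every `z` (`t > 0`). [folklore] -/
theorem hopfLaxPotential_le_laxFunction (hm : Measurable u₀) (hM : ∀ x, |u₀ x| ≤ M) {t : ℝ}
    (ht : 0 < t) (x z : ℝ) : hopfLaxPotential u₀ t x ≤ laxFunction u₀ t x z := by
  rw [hopfLaxPotential_of_pos u₀ ht]
  exact laxFunction_laxMinimizer_le hm hM ht x z

/-- `W(t,x) ≤ U₀(x)`. [folklore] -/
theorem hopfLaxPotential_le_burgersPrimitive (hm : Measurable u₀) (hM : ∀ x, |u₀ x| ≤ M)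
    (t x : ℝ) : hopfLaxPotential u₀ t x ≤ burgersPrimitive u₀ x := by
  by_cases ht : 0 < t
  · simpa using hopfLaxPotential_le_laxFunction hm hM ht x x
  · rw [hopfLaxPotential_of_nonpos u₀ (not_lt.1 ht)]

/-- `U₀(x) - M² t/2 ≤ W(t,x)` for `t ≥ 0`: the potential is continuous up to `t = 0`.
[folklore] -/
theorem burgersPrimitive_sub_le_hopfLaxPotential (hm : Measurable u₀) (hM : ∀ x, |u₀ x| ≤ M)
    {t : ℝ} (ht : 0 ≤ t) (x : ℝ) :
    burgersPrimitive u₀ x - M ^ 2 * t / 2 ≤ hopfLaxPotential u₀ t x := by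
  rcases ht.eq_or_lt with rfl | ht
  · simp [hopfLaxPotential_of_nonpos u₀ le_rfl]
  · rw [hopfLaxPotential_of_pos u₀ ht]
    exact laxFunction_ge' hm hM ht x _

end Literature.Analysis.PDE
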